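import Summits.AtomisticToContinuum.HydrodynamicLimit.Theses.JParityClosure
import Literature.Probability.Divergences.KLDivConvexity
import Literature.Probability.Entropy.DonskerVaradhanTransfer

/-!
# Sketch — crux-ideate stmt-AtomisticToContinuum-17722 (OddContactSymmetry, rev 5), ideator 2, round 1

Idea `gaussian-branch-window-transfer`: the relative entropy `H(μ_t | G)` of the true law w.r.t. the
flow-INVARIANT Gibbs law is a constant of motion (`= H(LG | G) ≤ h·(N+1)`), so the Donsker–Varadhan
entropy inequality can be spent on EVERY mesoscopic time window separately (equivalently: Hölder over
shifts under the invariant law, tree `integral_exp_sum_range_iterate_le`).  Inside a window of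
`L_N → ∞` mean free times the Metropolis-weighted J-odd collision statistic self-averages over
`≍ N·L_N` bounded marks, so the ONLY equilibrium input needed is the GAUSSIAN branch of its log-moment
generating function under `G` (CLT-scale variance, tilts up to `√(2h(N+1)/v_N)`), never a
super-exponential bound.  §1–§2 are the deterministic part of that line, stated and proved abstractly.
-/

namespace Summit.AtomisticToContinuum.HydrodynamicLimit.Cruxes.OddContactSymmetry.IdeatorWindow

open MeasureTheory InformationTheory
open scoped ENNReal

noncomputable section

/-! ## §1  Gaussian entropy transfer (one window) -/

/-- **Gaussian-branch entropy transfer.**  If `KL(μ‖ν) ≤ H` and a bounded observable `X` has a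
sub-Gaussian centred moment generating function under the REFERENCE law `ν` with variance proxy `v`
for all tilts `|a| ≤ ā`, and the optimal tilt `√(2H/v)` is admissible, then the `μ`-mean of `X`
differs from its `ν`-mean by at most `√(2Hv)`.  (Entropy inequality in log form, tree
`Literature.Probability.Divergences.integral_le_toReal_klDiv_add_log`, at `ψ = ±a(X − m)`, then
optimise `a`.)  With `H = h(N+1)` (local Gibbs vs invariant Gibbs) and `v = v_N` the CLT-scale
variance of a window statistic this is the per-window bound of the card. [folklore] -/
theorem gaussian_entropy_transfer {Ω : Type*} [MeasurableSpace Ω] {μ ν : Measure Ω}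
    [IsProbabilityMeasure μ] [IsProbabilityMeasure ν] (hfin : klDiv μ ν ≠ ⊤)
    {H v abar C : ℝ} (hH : 0 < H) (hv : 0 < v) (hHle : (klDiv μ ν).toReal ≤ H)
    {X : Ω → ℝ} (hX : Measurable X) (hC : ∀ ω, |X ω| ≤ C)
    (hmgf : ∀ a : ℝ, |a| ≤ abar →
      ∫ ω, Real.exp (a * (X ω - ∫ ω', X ω' ∂ν)) ∂ν ≤ Real.exp (a ^ 2 * v / 2))
    (hα : Real.sqrt (2 * H / v) ≤ abar) :
    |∫ ω, X ω ∂μ - ∫ ω, X ω ∂ν| ≤ Real.sqrt (2 * H * v) := by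
  set m : ℝ := ∫ ω', X ω' ∂ν with hm
  set a : ℝ := Real.sqrt (2 * H / v) with ha
  have h2Hv : 0 < 2 * H / v := div_pos (mul_pos two_pos hH) hv
  have ha_pos : 0 < a := Real.sqrt_pos.2 h2Hv
  have ha_sq : a ^ 2 = 2 * H / v := by rw [ha, Real.sq_sqrt h2Hv.le]
  have hXμ : Integrable X μ :=
    Integrable.of_bound hX.aestronglyMeasurable C (ae_of_all _ fun ω => by
      rw [Real.norm_eq_abs]; exact hC ω)
  -- the one-sided bounds for `s = ±1`
  have key : ∀ s : ℝ, |s| = 1 → s * a * (∫ ω, X ω ∂μ - m) ≤ H + a ^ 2 * v / 2 := by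
    intro s hs
    have hsa : |s * a| ≤ abar := by
      rw [abs_mul, hs, one_mul, abs_of_pos ha_pos]; exact hα
    have hψm : Measurable (fun ω => s * a * (X ω - m)) :=
      (hX.sub measurable_const).const_mul _
    have hψb : ∀ ω, |s * a * (X ω - m)| ≤ a * (C + |m|) := by
      intro ω
      rw [abs_mul, abs_mul, hs, one_mul, abs_of_pos ha_pos]
      refine mul_le_mul_of_nonneg_left ?_ ha_pos.le
      calc |X ω - m| ≤ |X ω| + |m| := abs_sub _ _
        _ ≤ C + |m| := by linarith [hC ω]
    have hexpi : Integrable (fun ω => Real.exp (s * a * (X ω - m))) ν :=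
      Integrable.of_bound hψm.exp.aestronglyMeasurable (Real.exp (a * (C + |m|)))
        (ae_of_all _ fun ω => by
          rw [Real.norm_eq_abs, abs_of_pos (Real.exp_pos _)]
          exact Real.exp_le_exp.2 ((le_abs_self _).trans (hψb ω)))
    have h1 := Literature.Probability.Divergences.integral_le_toReal_klDiv_add_log
      (μ := μ) (ν := ν) hfin hψm hψb
    have hpos : 0 < ∫ ω, Real.exp (s * a * (X ω - m)) ∂ν := integral_exp_pos hexpi
    have h2 : Real.log (∫ ω, Real.exp (s * a * (X ω - m)) ∂ν) ≤ (s * a) ^ 2 * v / 2 := by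
      calc Real.log (∫ ω, Real.exp (s * a * (X ω - m)) ∂ν)
          ≤ Real.log (Real.exp ((s * a) ^ 2 * v / 2)) :=
            Real.log_le_log hpos (hmgf (s * a) hsa)
        _ = (s * a) ^ 2 * v / 2 := Real.log_exp _
    have h3 : ∫ ω, s * a * (X ω - m) ∂μ = s * a * (∫ ω, X ω ∂μ - m) := by
      rw [integral_const_mul, integral_sub hXμ (integrable_const m), integral_const, smul_eq_mul,
        probReal_univ, one_mul]
    have hs2 : (s * a) ^ 2 = a ^ 2 := by
      rw [mul_pow, ← sq_abs s, hs]; ring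
    rw [h3] at h1
    rw [hs2] at h2
    linarith
  have hplus := key 1 (by simp)
  have hminus := key (-1) (by simp)
  have hv0 : v ≠ 0 := hv.ne'
  have hB : H + a ^ 2 * v / 2 = 2 * H := by
    rw [ha_sq]; field_simp; ring
  rw [hB] at hplus hminus
  have hup : (∫ ω, X ω ∂μ - m) ≤ 2 * H / a := by
    rw [le_div_iff₀ ha_pos]; nlinarith [hplus]
  have hlo : -(∫ ω, X ω ∂μ - m) ≤ 2 * H / a := by
    rw [le_div_iff₀ ha_pos]; nlinarith [hminus]
  have hD : |∫ ω, X ω ∂μ - m| ≤ 2 * H / a := abs_le.2 ⟨by linarith, hup⟩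
  have hfinal : Real.sqrt (2 * H * v) = 2 * H / a := by
    rw [Real.sqrt_eq_iff_mul_self_eq (mul_nonneg (mul_nonneg two_pos.le hH.le) hv.le)
      (div_nonneg (mul_nonneg two_pos.le hH.le) ha_pos.le)]
    have h1 : 2 * H / a * (2 * H / a) = 4 * H ^ 2 / a ^ 2 := by ring
    rw [h1, ha_sq]
    field_simp
    ring
  rw [hfinal]
  exact hD

/-! ## §2  The windowed transfer: Hölder over shifts under the invariant law + §1 -/

/-- **Windowed Gaussian transfer.**  Let `ν` be invariant under `T` (one window of the flow),
`KL(μ‖ν) ≤ H`, and let the one-window statistic `f` (bounded, measurable) have a sub-Gaussian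
centred MGF under `ν` with variance proxy `v` for tilts `|a| ≤ ā`, with `√(2H/v) ≤ ā`.  Then the
`μ`-mean of the `W`-window sum `∑_{w<W} f ∘ T^[w]` differs from `W·∫f dν` by at most `W·√(2Hv)`:
the ENTIRE entropy budget `H` is charged to every window, and the loss is only `√W` against a
single-shot bound with full-sum variance `Wv` — affordable when `v` shrinks linearly with the window
length (CLT inside the window) while `H = O(N)`.  Proof: Hölder over shifts
(`Literature.Probability.Entropy.integral_exp_sum_range_iterate_le`) turns the MGF of the sum at tilt
`a` into the one-window MGF at tilt `W a`, so §1 applies with proxy `W²v` and `ā/W`. [folklore] -/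
theorem windowed_gaussian_transfer {Ω : Type*} [MeasurableSpace Ω] {μ ν : Measure Ω}
    [IsProbabilityMeasure μ] [IsProbabilityMeasure ν] (hfin : klDiv μ ν ≠ ⊤)
    {T : Ω → Ω} (hT : MeasurePreserving T ν ν) (hTm : Measurable T)
    {H v abar C : ℝ} (hH : 0 < H) (hv : 0 < v) (hHle : (klDiv μ ν).toReal ≤ H)
    {f : Ω → ℝ} (hf : Measurable f) (hC : ∀ ω, |f ω| ≤ C) {W : ℕ} (hW : 0 < W)
    (hmgf : ∀ a : ℝ, |a| ≤ abar →
      ∫ ω, Real.exp (a * (f ω - ∫ ω', f ω' ∂ν)) ∂ν ≤ Real.exp (a ^ 2 * v / 2))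
    (hα : Real.sqrt (2 * H / v) ≤ abar) :
    |∫ ω, (∑ w ∈ Finset.range W, f (T^[w] ω)) ∂μ - W * ∫ ω, f ω ∂ν| ≤
      W * Real.sqrt (2 * H * v) := by
  classical
  set m : ℝ := ∫ ω', f ω' ∂ν with hm
  set X : Ω → ℝ := fun ω => ∑ w ∈ Finset.range W, f (T^[w] ω) with hX
  have hW0 : (0 : ℝ) < W := by exact_mod_cast hW
  have hWne : (W : ℝ) ≠ 0 := hW0.ne'
  have hv0 : v ≠ 0 := hv.ne'
  have h2Hv : 0 < 2 * H / v := div_pos (mul_pos two_pos hH) hv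
  -- measurability and boundedness of the window sum
  have hXm : Measurable X :=
    Finset.measurable_sum _ fun w _ => hf.comp (hTm.iterate w)
  have hXb : ∀ ω, |X ω| ≤ W * C := by
    intro ω
    calc |X ω| ≤ ∑ w ∈ Finset.range W, |f (T^[w] ω)| := Finset.abs_sum_le_sum_abs _ _
      _ ≤ ∑ w ∈ Finset.range W, C := Finset.sum_le_sum fun w _ => hC _
      _ = W * C := by rw [Finset.sum_const, Finset.card_range, nsmul_eq_mul]
  -- the `ν`-mean of the window sum is `W m` (invariance)
  have hXν : ∫ ω, X ω ∂ν = W * m := by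
    have hterm : ∀ w ∈ Finset.range W, ∫ ω, f (T^[w] ω) ∂ν = m := by
      intro w _
      have h1 := integral_map (μ := ν) ((hTm.iterate w).aemeasurable)
        (hf.aestronglyMeasurable (μ := Measure.map T^[w] ν))
      rw [(hT.iterate w).map_eq] at h1
      exact h1.symm
    have hint : ∀ w ∈ Finset.range W, Integrable (fun ω => f (T^[w] ω)) ν := fun w _ =>
      Integrable.of_bound (hf.comp (hTm.iterate w)).aestronglyMeasurable C
        (ae_of_all _ fun ω => by rw [Real.norm_eq_abs]; exact hC _)
    rw [hX]
    simp only
    rw [integral_finsetSum _ hint, Finset.sum_congr rfl hterm, Finset.sum_const, Finset.card_range,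
      nsmul_eq_mul]
  -- the MGF of the window sum at tilt `a` is the one-window MGF at tilt `W a` (Hölder over shifts)
  have hmgfX : ∀ a : ℝ, |a| ≤ abar / W →
      ∫ ω, Real.exp (a * (X ω - ∫ ω', X ω' ∂ν)) ∂ν ≤ Real.exp (a ^ 2 * ((W : ℝ) ^ 2 * v) / 2) := by
    intro a ha
    have hWa : |W * a| ≤ abar := by
      rw [abs_mul, Nat.abs_cast]
      rwa [le_div_iff₀' hW0] at ha
    set g : Ω → ℝ := fun ω => a * (f ω - m) with hg
    have hgm : Measurable g := (hf.sub measurable_const).const_mul _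
    have hsum : ∀ ω, a * (X ω - ∫ ω', X ω' ∂ν) = ∑ w ∈ Finset.range W, g (T^[w] ω) := by
      intro ω
      rw [hXν, hX]
      simp only [hg]
      rw [← Finset.mul_sum, Finset.sum_sub_distrib, Finset.sum_const, Finset.card_range,
        nsmul_eq_mul]
    have hint : Integrable (fun ω => Real.exp (W * g ω)) ν := by
      have hb : ∀ ω, |W * g ω| ≤ |W * a| * (C + |m|) := by
        intro ω
        simp only [hg]
        rw [← mul_assoc, abs_mul]
        refine mul_le_mul_of_nonneg_left ?_ (abs_nonneg _)
        calc |f ω - m| ≤ |f ω| + |m| := abs_sub _ _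
          _ ≤ C + |m| := by linarith [hC ω]
      refine Integrable.of_bound (hgm.const_mul _).exp.aestronglyMeasurable
        (Real.exp (|W * a| * (C + |m|))) (ae_of_all _ fun ω => ?_)
      rw [Real.norm_eq_abs, abs_of_pos (Real.exp_pos _)]
      exact Real.exp_le_exp.2 ((le_abs_self _).trans (hb ω))
    have hH' := Literature.Probability.Entropy.integral_exp_sum_range_iterate_le
      (μ := ν) hT hgm hW hint
    simp_rw [hsum]
    refine hH'.trans ?_
    have hone : ∫ ω, Real.exp (W * g ω) ∂ν ≤ Real.exp ((W * a) ^ 2 * v / 2) := by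
      have := hmgf (W * a) hWa
      simp only [hg]
      simpa [mul_assoc] using this
    refine hone.trans (le_of_eq ?_)
    congr 1; ring
  -- apply §1 with proxy `W² v` and admissible range `ā / W`
  have hv' : 0 < (W : ℝ) ^ 2 * v := by positivity
  have hα' : Real.sqrt (2 * H / ((W : ℝ) ^ 2 * v)) ≤ abar / W := by
    have : Real.sqrt (2 * H / ((W : ℝ) ^ 2 * v)) = Real.sqrt (2 * H / v) / W := by
      rw [show 2 * H / ((W : ℝ) ^ 2 * v) = 2 * H / v / (W : ℝ) ^ 2 by
        rw [div_div, mul_comm v ((W : ℝ) ^ 2)],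
        Real.sqrt_div h2Hv.le, Real.sqrt_sq hW0.le]
    rw [this]
    exact div_le_div_of_nonneg_right hα hW0.le
  have key := gaussian_entropy_transfer (μ := μ) (ν := ν) hfin hH hv' hHle hXm hXb hmgfX hα'
  rw [hXν] at key
  have hsq : Real.sqrt (2 * H * ((W : ℝ) ^ 2 * v)) = W * Real.sqrt (2 * H * v) := by
    rw [show 2 * H * ((W : ℝ) ^ 2 * v) = (W : ℝ) ^ 2 * (2 * H * v) by ring,
      Real.sqrt_mul (sq_nonneg _), Real.sqrt_sq hW0.le]
  rw [hsq] at key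
  exact key

/-! ## §3  (idea `prompt-cluster-locality`) the long-flight tail of the first-order return integral

The zero-frequency first-order ring correlation integrates the return geometry over the intermediate
flight time `t`; in `d = 3` the returning solid angle is `(σ/(|g| t))²` for `t ≫ σ/|g|` (Ernst 1998 (17);
tree `ZeroFrequencyRingOperator.lean`, "solid angle `(σ/|v₁₂|t)^{d-1}`"), and is `O(1)` for
`t ≲ σ/|g|`.  The tail beyond `C` sphere-crossing times is therefore `σ/(C|g|)` against a prompt part
of order `σ/|g|`: the first-order odd contact correlation is created in PROMPT few-body encounters
(flights `≲ Cσ`), up to a relative error `1/C`. -/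

/-- **Long-flight tail.**  For `σ, g, C > 0`: `∫_{t > Cσ/g} (σ/(g t))² dt = σ/(C g)`. [folklore] -/
theorem longFlight_tail_integral {σ g C : ℝ} (hσ : 0 < σ) (hg : 0 < g) (hC : 0 < C) :
    ∫ t in Set.Ioi (C * σ / g), (σ / (g * t)) ^ 2 = σ / (C * g) := by
  have ha : 0 < C * σ / g := by positivity
  have h1 : ∀ t ∈ Set.Ioi (C * σ / g), (σ / (g * t)) ^ 2 = (σ / g) ^ 2 * t ^ (-2 : ℝ) := by
    intro t ht
    have ht0 : 0 < t := ha.trans ht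
    rw [Real.rpow_neg ht0.le, Real.rpow_two, div_pow, mul_pow]
    field_simp
  rw [setIntegral_congr_fun measurableSet_Ioi h1, integral_const_mul,
    integral_Ioi_rpow_of_lt (by norm_num : (-2 : ℝ) < -1) ha]
  have hCσg : (C * σ / g) ^ ((-2 : ℝ) + 1) = g / (C * σ) := by
    rw [show (-2 : ℝ) + 1 = -1 by norm_num, Real.rpow_neg_one, inv_div]
  rw [hCσg]
  field_simp
  ring

end

end Summit.AtomisticToContinuum.HydrodynamicLimit.Cruxes.OddContactSymmetry.IdeatorWindow
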